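import Literature.IUT.HodgeTheaters.GlobalFrobenioidsCoricRigidityFieldLevelOfFG
import Literature.IUT.HodgeTheaters.GlobalFrobenioidsCoricRigidityFieldLevelDivIndependence
import Literature.IUT.HodgeTheaters.KappaCoricGaloisInvariantsProofs
import Literature.IUT.HodgeTheaters.KappaCoricPseudoMonoidsProofs
import Literature.IUT.HodgeTheaters.GlobalFrobenioidsCoricRigidityOfDivisors
import Mathlib.FieldTheory.Galois.Infinite
import Mathlib.RingTheory.RootsOfUnity.AlgebraicallyClosed
import HarnessLib

/-!
# [IUTchI] Example 5.1 (v), ∞κ field-level binder set INHABITED at an ARITHMETIC function-field model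
# `K_rat := (ℚ(t))‾`, `π₁^rat := Gal((ℚ(t))‾/ℚ(t))`, `𝕄^⊛_∞κ :=` the ∞κ-coric elements (PROOF-ONLY; NV annex A3)

Mochizuki, *Inter-universal Teichmüller theory I*, kurims manuscript (May 2020): §5 Example 5.1 (i), p. 123 l. 56 –
p. 124 l. 7 (cell render lit/IUTchI-EX51-i-iv-vii-VERBATIM.md l.17) "we conclude that we may construct
group-theoretically from `π₁(†𝒟^⊚)`, in a functorial fashion, an isomorph `π₁^rat(†𝒟^⊛) (↠ π₁(†𝒟^⊛))` of the
absolute Galois group of the function field of `C_{F_mod}` […] as well as isomorphs of the pseudo-monoids of `κ`-,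
`∞κ`-, and `∞κ×`-coric rational functions associated to `C_{F_mod}` [cf. the discussion of Remark 3.1.7, (i), (ii)
[…]]"; §3 Remark 3.1.7
(ii) p. 67 l. 36–42 (decorated render lit/renders/IUTchI-SEC3-6-DECORATED.txt l.81) "We shall say that an element
`f ∈ L̄_C` is `∞κ`-coric if there exists a positive integer `n` such that `fⁿ` is a `κ`-coric element of `L_C`"
([IUTchI] Ex 5.1 (v) p.127; Rmk 3.1.7 (ii) p.67) [claim: Mochizuki2012, status: disputed] (D-0012 claim key; the
content below is a MODEL in elementary field theory; nothing disputed is asserted; no side is taken on [IUTchIII]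
Cor. 3.12).

WHAT (cell abc-iut, layer-5 certificate, conjunct E51/L29 at the field level; abc-iut-w4-d050 gen 5, STEP-0 report
14:04Z).  The NV annexes A2 (p441507) / A2′ (p449088) inhabit the field-level binder set of the closers
`NFBridgeRecon.existsUniqueCoricStructure_infκPair_fieldLevel(_of_fg)` at a datum whose FUNCTION-FIELD side is
DEGENERATE (`K_rat := ℚ̄`).  THIS FILE (PROOF-ONLY: no `def`, no `instance`, no `structure`, no new Prop fact)
inhabits the ∞κ binder set WITH `hfg` at an ARITHMETIC FUNCTION-FIELD model of print's shape
(`NFBridgeRecon.CoricArithmeticToy.exists_infκ_fieldLevel_laws_arithmetic`):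

* `L := ℚ` (playing `F_mod`), abc-iut-L5-t2's strictly critical locus `S := {0, 9, 16} ⊆ ℚ` (`CriticalLocus ℚ`);
* `K_rat := Λ :=` an algebraic closure of `ℚ(t) = RatFunc ℚ` (playing `L̄_C`), `π₁^rat := Gal(Λ/ℚ(t))` with its Krull
  topology (profinite; abc-iut-L5-t2's `isGalois_algebraicClosure_ratFunc`), acting tautologically and smoothly;
* `𝕄^⊛_κ = 𝕄^⊛_∞κ := {f ∈ Λ | f is ∞κ-coric}` in abc-iut-L5-t2's sense `CriticalLocus.IsInftyKappaCoricIn S Λ`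
  (`fⁿ` = a `κ`-coric rational function for some `n ≥ 1`); `𝕄^⊛_∞κ× := 𝕄^⊛_∞κ` [HONEST: the ∞κ× side is
  COLLAPSED — print's unit parameter `U_L̄ = L̄^×` is not expressible at `Ω = ℚ` in the `U ⊆ Ω` typing];
* `X := ℚ` (points of the affine line), `ord_x f := mult_x(num g) − mult_x(denom g)` for `f = g ∈ ℚ(t)`, `0` else;
* Galois side TAUTOLOGICAL: `π₁(†𝒟^⊛) := π₁^rat`, `𝕄̄^⊛ := Λ`, `const := id` (the E51 field-level binders do not
  read it).

At this datum ALL binders of `existsUniqueCoricStructure_infκPair_fieldLevel_of_fg` are THEOREMS: `hroot`/`hprim`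
(`Λ` algebraically closed of characteristic `0`), `h1`/`hpow` (abc-iut-L5-t2/L5-d3:
`isInftyKappaCoricIn_of_pow_eq_one`, `isInftyKappaCoricIn_pow_iff`), **`hfg`** (the fixed field of an open subgroup
of `Gal(Λ/ℚ(t))` is FINITE over `ℚ(t)` — Mathlib `InfiniteGalois.isOpen_iff_finite` — hence inside `ℚ(t, basis)`,
and `ℚ(t) ⊆ ℚ(t′)` for `t′` the image of `t`), `hordmul` (Galois descent `InfiniteGalois.mem_bot_iff_fixed`: fixed
elements are rational functions; abc-iut-w4-d056's `ratFunc_ord_mul`), `hpole` (abc-iut-L5-t2's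
`isInftyKappaCoricIn_and_fixed_iff`: a fixed ∞κ-coric element is a κ-coric rational function; abc-iut-w4-d056's
`IsKappaCoric.not_two_poles`), and `hex` by the EXPLICIT κ-coric function **`f₀ := (t−8)(t−18)/(t−12)²`** over `ℚ`
(two rational zeroes `8, 18`, the single pole `12`, equal degrees, avoiding `S`, and `f₀(0) = 1`, `f₀(9) = f₀(16) = −1`
— roots of unity at every strictly critical point; `IsKappaCoric.exists_two_zeroes`).  Also recorded: the old law
(iv) `hdiv` holds there (my `hdiv_of_fixed_subset_adjoin_finset`), and the closer FIRES
(`exists_infκ_fieldLevel_of_fg_fires_arithmetic`).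

(v2, doc-only, referee note ref-m M20-F2: the Ex. 5.1 (i) locator widened to «p. 123 l. 56 – p. 124 l. 7» — the
absolute-Galois-group and pseudo-monoid clauses sit on p. 124 — and the untyped «∞κ× closer fires too» sentence of the
last docstring marked as a remark with a pointer to its typed form; no declaration changed.)

HONEST LABEL: NV annex (A3) — «[arithmetic function-field model; ∞κ× side collapsed (U := {1}); Galois side
tautological]»; a model inhabitant witnesses the joint satisfiability of OUR typed binders at a print-shaped
function-field datum, nothing about the genuine `C_{F_mod}`; inhabited ≠ discharged; no census change by itself;
typed ≠ proved; no side is taken on [IUTchIII] Cor. 3.12 (nor [IUTchI]).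
-/

noncomputable section

namespace Literature.IUT.HodgeTheaters

namespace NFBridgeRecon

namespace CoricArithmeticToy

open Polynomial CriticalLocus
open scoped IntermediateField Classical

/-- Uniqueness of the normalised numerator/denominator of `p / q` for `q` monic and coprime to `p` (re-proved here;
abc-iut-L5-t2's copy in `KappaCoricFunctionsExistence` is private). [folklore] -/
private theorem num_denom_div_of_isCoprime {p q : ℚ[X]} (hq : q.Monic) (hpq : IsCoprime p q) :
    (algebraMap ℚ[X] (RatFunc ℚ) p / algebraMap ℚ[X] (RatFunc ℚ) q).num = p ∧
      (algebraMap ℚ[X] (RatFunc ℚ) p / algebraMap ℚ[X] (RatFunc ℚ) q).denom = q := by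
  set x := algebraMap ℚ[X] (RatFunc ℚ) p / algebraMap ℚ[X] (RatFunc ℚ) q with hx
  have h : x.num * q = p * x.denom := (RatFunc.num_mul_eq_mul_denom_iff hq.ne_zero).mpr rfl
  have h1 : q ∣ x.denom := by
    refine (hpq.symm).dvd_of_dvd_mul_left ⟨x.num, ?_⟩
    rw [← h, mul_comm]
  have h2 : x.denom ∣ q := by
    refine (RatFunc.isCoprime_num_denom x).symm.dvd_of_dvd_mul_left ⟨p, ?_⟩
    rw [h, mul_comm]
  have hd : x.denom = q :=
    (Polynomial.eq_of_monic_of_associated (RatFunc.monic_denom x) hq (associated_of_dvd_dvd h2 h1))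
  refine ⟨?_, hd⟩
  rw [hd] at h
  exact mul_right_cancel₀ hq.ne_zero h

/-- The strictly critical locus `S := {0, 9, 16} ⊆ ℚ` has three points. [folklore] -/
private theorem card_S : ({0, 9, 16} : Finset ℚ).card = 3 := by
  rw [Finset.card_insert_of_notMem (by norm_num), Finset.card_insert_of_notMem (by norm_num),
    Finset.card_singleton]

/-- **An explicit κ-coric rational function over `ℚ` for `S = {0, 9, 16}`**: `f₀ := (t−8)(t−18)/(t−12)²` is κ-coric
in abc-iut-L5-t2's sense (Rmk 3.1.7 (i): exactly one pole, two distinct zeroes, algebraic divisor avoiding the critical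
points and the cusp, a root of unity — here `±1` — at every strictly critical point), and is not constant.
([IUTchI] Rmk 3.1.7 (i) p.67) [claim: Mochizuki2012, status: disputed] -/
theorem exists_isKappaCoric_rat :
    ∃ f : RatFunc ℚ, (⟨{0, 9, 16}, card_S⟩ : CriticalLocus ℚ).IsKappaCoric f ∧ ∀ c : ℚ, f ≠ RatFunc.C c := by
  set S : CriticalLocus ℚ := ⟨{0, 9, 16}, card_S⟩ with hS
  set P : ℚ[X] := (X - C 8) * (X - C 18) with hP
  set Q : ℚ[X] := (X - C 12) ^ 2 with hQ
  have hPe : ∀ t : ℚ, P.eval t = (t - 8) * (t - 18) := fun t => by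
    simp only [hP, eval_mul, eval_sub, eval_X, eval_C]
  have hQe : ∀ t : ℚ, Q.eval t = (t - 12) ^ 2 := fun t => by
    simp only [hQ, eval_pow, eval_sub, eval_X, eval_C]
  have hQm : Q.Monic := (monic_X_sub_C (12 : ℚ)).pow 2
  have hP0 : P ≠ 0 := mul_ne_zero (X_sub_C_ne_zero 8) (X_sub_C_ne_zero 18)
  have hcop : IsCoprime P Q := by
    have h1 : IsCoprime (X - C (12 : ℚ)) P := by
      rw [(irreducible_X_sub_C (12 : ℚ)).coprime_iff_not_dvd, dvd_iff_isRoot, IsRoot.def, hPe]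
      norm_num
    exact h1.symm.pow_right
  set f : RatFunc ℚ := algebraMap ℚ[X] (RatFunc ℚ) P / algebraMap ℚ[X] (RatFunc ℚ) Q with hf
  obtain ⟨hnum, hden⟩ : f.num = P ∧ f.denom = Q := num_denom_div_of_isCoprime hQm hcop
  have hfe : ∀ t : ℚ, f.eval (RingHom.id ℚ) t = (t - 8) * (t - 18) / (t - 12) ^ 2 := fun t => by
    rw [RatFunc.eval, hnum, hden, eval₂_id, eval₂_id, hPe, hQe]
  have hmemS : ∀ e : ℚ, e ∈ S.pts ↔ e = 0 ∨ e = 9 ∨ e = 16 := fun e => by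
    simp only [hS, Finset.mem_insert, Finset.mem_singleton]
  refine ⟨f, ⟨fun _ => ⟨?_, ?_⟩, fun z _ => ?_, ⟨fun e he => ?_, fun e he => ?_, ?_⟩, fun e he => ⟨2, two_pos, ?_⟩⟩,
    fun c hc => ?_⟩
  · -- exactly one pole, `12` (the `toFinset` in abc-iut-L5-t2's `poles` carries a classical instance: `convert`)
    have h : (Q.roots.toFinset : Finset ℚ).card = 1 := by
      rw [hQ, roots_pow, roots_X_sub_C, Multiset.toFinset_nsmul _ _ (by norm_num), Multiset.toFinset_singleton,
        Finset.card_singleton]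
    rw [poles, hden]
    convert h using 3
  · -- two distinct zeroes, `8` and `18`
    have h : 2 ≤ (P.roots.toFinset : Finset ℚ).card := by
      rw [hP, roots_mul hP0, roots_X_sub_C, roots_X_sub_C]
      decide
    rw [zeroes, hnum]
    convert h using 3
  · -- the divisor is algebraic (everything is rational)
    exact isAlgebraic_algebraMap (R := ℚ) z
  · -- no zero at a strictly critical point
    rw [hnum, hPe]
    rcases (hmemS e).mp he with rfl | rfl | rfl <;> norm_num
  · -- no pole at a strictly critical point
    rw [hden, hQe]
    rcases (hmemS e).mp he with rfl | rfl | rfl <;> norm_num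
  · -- no zero or pole at the cusp: equal degrees
    rw [hnum, hden, hP, hQ, natDegree_mul (X_sub_C_ne_zero 8) (X_sub_C_ne_zero 18), natDegree_X_sub_C,
      natDegree_X_sub_C, (monic_X_sub_C (12 : ℚ)).natDegree_pow, natDegree_X_sub_C]
  · -- values `±1` at the strictly critical points
    rw [hfe]
    rcases (hmemS e).mp he with rfl | rfl | rfl <;> norm_num
  · -- not constant: the values at `0` and `9` differ
    have h0 := hfe 0
    have h9 := hfe 9
    rw [hc, RatFunc.eval_C, RingHom.id_apply] at h0 h9
    norm_num at h0 h9
    rw [h0] at h9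
    norm_num at h9

/-- **A3 — the ∞κ field-level binder set WITH `hfg` (and the old (iv) `hdiv`) INHABITED at the arithmetic
function-field model** `K_rat := (ℚ(t))‾`, `π₁^rat := Gal((ℚ(t))‾/ℚ(t))`, `𝕄^⊛_∞κ :=` the ∞κ-coric elements for
`S = {0, 9, 16}`, `X := ℚ`, `ord :=` order of vanishing of rational functions: `char K_rat = 0`, `hroot`, `hprim`, `h1`,
`hpow`, `hfg`, `hdiv`, `hordmul`, `hpole`, `hex` — verbatim binder shapes of
`existsUniqueCoricStructure_infκPair_fieldLevel_of_fg` / `…_fieldLevel`.  NV annex; «[arithmetic function-field model;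
∞κ× side collapsed; Galois side tautological]»; inhabited ≠ discharged.
([IUTchI] Ex 5.1 (v) pp.127–128; Rmk 3.1.7 (ii) p.67) [claim: Mochizuki2012, status: disputed] -/
theorem exists_infκ_fieldLevel_laws_arithmetic :
    ∃ (N : NFBridgeRecon.{0}) (_ : CharZero N.Krat) (X : Type) (ord : X → N.Krat → ℤ),
      (∀ a : N.Krat, a ≠ 0 → ∀ n : ℕ, 0 < n → ∃ b : N.Krat, b ^ n = a) ∧
      (∀ n : ℕ, 0 < n → ∃ ζ : N.Krat, IsPrimitiveRoot ζ n) ∧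
      (1 : N.Krat) ∈ N.Minfκ ∧
      (∀ (f : N.Krat) (n : ℕ), 0 < n → (f ∈ N.Minfκ ↔ f ^ n ∈ N.Minfκ)) ∧
      (∀ H : OpenNormalSubgroup N.piRat, ∃ s : Finset N.Krat,
        ∀ a : N.Krat, (∀ h : N.piRat, h ∈ H → h • a = a) → a ∈ IntermediateField.adjoin ℚ (s : Set N.Krat)) ∧
      (∀ (H : OpenNormalSubgroup N.piRat) (a : N.Krat), a ≠ 0 → (∀ h : N.piRat, h ∈ H → h • a = a) →
        (∀ n : ℕ+, ∃ b : N.Krat, (∀ h : N.piRat, h ∈ H → h • b = b) ∧ b ^ (n : ℕ) = a) → a = 1) ∧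
      (∀ (x : X) (a b : N.Krat), a ≠ 0 → b ≠ 0 → (∀ g : N.piRat, g • a = a) → (∀ g : N.piRat, g • b = b) →
        ord x (a * b) = ord x a + ord x b) ∧
      (∀ f' ∈ N.Minfκ, (∀ g : N.piRat, g • f' = f') →
        ∀ x₁ x₂ : X, x₁ ≠ x₂ → ¬ (ord x₁ f' < 0 ∧ ord x₂ f' < 0)) ∧
      (∃ f ∈ N.Minfκ, (∀ g : N.piRat, g • f = f) ∧ ∃ x₁ x₂ : X, x₁ ≠ x₂ ∧ 0 < ord x₁ f ∧ 0 < ord x₂ f) := by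
  classical
  set S : CriticalLocus ℚ := ⟨{0, 9, 16}, card_S⟩ with hS
  let F : Type := RatFunc ℚ
  let K : Type := AlgebraicClosure F
  haveI hGal : IsGalois F K := isGalois_algebraicClosure_ratFunc (Ω := ℚ)
  let G : ProfiniteGrp.{0} := ProfiniteGrp.of (K ≃ₐ[F] K)
  let ρ : G →ₜ* (K ≃ₐ[F] K) := ContinuousMonoidHom.id G
  letI act : MulSemiringAction G K := MulSemiringAction.compHom K (ρ : G →* (K ≃ₐ[F] K))
  have hsmul : ∀ (g : G) (f : K), g • f = (g : K ≃ₐ[F] K) f := fun _ _ => rfl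
  let ι : F →+* K := algebraMap F K
  have hinj : Function.Injective ι := (algebraMap F K).injective
  -- smoothness of the action
  have hopen : ∀ x : K, IsOpen (MulAction.stabilizer G x : Set G) := by
    intro x
    have hx : IsIntegral F x := Algebra.IsIntegral.isIntegral x
    haveI : FiniteDimensional F F⟮x⟯ := IntermediateField.adjoin.finiteDimensional hx
    have hopen' : IsOpen (MulAction.stabilizer (K ≃ₐ[F] K) x : Set (K ≃ₐ[F] K)) := by
      refine Subgroup.isOpen_mono ?_ (IntermediateField.fixingSubgroup_isOpen F⟮x⟯)
      intro σ hσ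
      rw [MulAction.mem_stabilizer_iff]
      exact (IntermediateField.mem_fixingSubgroup_iff _ _).1 hσ x (IntermediateField.mem_adjoin_simple_self F x)
    have hpre : (MulAction.stabilizer G x : Set G) = ρ ⁻¹' (MulAction.stabilizer (K ≃ₐ[F] K) x : Set (K ≃ₐ[F] K)) := by
      ext g
      simp only [SetLike.mem_coe, MulAction.mem_stabilizer_iff, Set.mem_preimage]
      rfl
    rw [hpre]
    exact hopen'.preimage ρ.continuous
  -- fixed elements are rational functions (Krull)
  have hfixed : ∀ f : K, (∀ g : G, g • f = f) → ∃ q : F, f = ι q := by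
    intro f hf
    obtain ⟨q, hq⟩ := IntermediateField.mem_bot.1 ((InfiniteGalois.mem_bot_iff_fixed f).2 fun g => hf g)
    exact ⟨q, hq.symm⟩
  have hfixσ : ∀ f : K, (∀ g : G, g • f = f) → ∀ σ : K ≃ₐ[F] K, σ f = f := fun f hf σ => hf σ
  have hfix_alg : ∀ (q : F) (g : G), g • ι q = ι q := fun q g => (g : K ≃ₐ[F] K).commutes q
  /- the ∞κ-coric elements -/
  let T : Set K := {f | S.IsInftyKappaCoricIn K f}
  have hT1 : (1 : K) ∈ T := S.isInftyKappaCoricIn_of_pow_eq_one K Nat.one_pos (one_pow 1)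
  have hT0 : (0 : K) ∉ T := by
    rintro ⟨n, hn, g, hg, h⟩
    rw [zero_pow hn.ne'] at h
    have hg0 : g = 0 := hinj (by rw [map_zero]; exact h.symm)
    have h0 : (0 : ℚ) ∈ S.pts := by simp [hS]
    have := hg.avoids.num_eval_ne 0 h0
    rw [hg0, RatFunc.num_zero, eval_zero] at this
    exact this rfl
  have hTpow : ∀ (f : K) (n : ℕ), 0 < n → (f ∈ T ↔ f ^ n ∈ T) := fun f n hn =>
    (S.isInftyKappaCoricIn_pow_iff K hn f).symm
  have hTsmul : ∀ (g : G) {f : K}, f ∈ T → g • f ∈ T := fun g f hf => by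
    rw [hsmul]
    exact hf.map_algEquiv S K _
  /- the interface datum -/
  let N : NFBridgeRecon.{0} :=
    { l := 5
      piDast := G
      piDcirc := ⊤
      Fbar := K
      fbarField := inferInstance
      fbarAction := act
      isOpen_stabilizer_fbar := hopen
      piRat := G
      ratToAst := ContinuousMonoidHom.id G
      ratToAst_surjective := Function.surjective_id
      Krat := K
      kratField := inferInstance
      kratAction := act
      isOpen_stabilizer_krat := hopen
      const := RingHom.id K
      const_smul := fun _ _ => rfl
      Mκ := T
      Minfκ := T
      Minfκx := T
      mκ_subset := subset_rfl
      minfκ_subset := subset_rfl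
      zero_notMem := hT0
      smul_mem_minfκ := fun g _ hf => hTsmul g hf
      smul_mem_minfκx := fun g _ hf => hTsmul g hf
      solKer := ⊤
      solKer_normal := inferInstance
      AutD := PUnit
      autGroup := inferInstance
      Autε := ⊤
      AutSL := ⊤
      AutSLε := ⊤
      autSLε_le := le_rfl
      autSLε_le_autε := le_rfl
      lift := fun _ => ContinuousMulEquiv.refl G }
  /- the order map: order of vanishing of rational functions at `x ∈ ℚ`, `0` elsewhere -/
  let ordF : ℚ → F → ℤ := fun x c => (c.num.rootMultiplicity x : ℤ) - c.denom.rootMultiplicity x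
  let ordK : ℚ → K → ℤ := fun x f => if h : ∃ c : F, f = ι c then ordF x h.choose else 0
  have ord_alg : ∀ (x : ℚ) (c : F), ordK x (ι c) = ordF x c := by
    intro x c
    have hh : ∃ c' : F, ι c = ι c' := ⟨c, rfl⟩
    have h1 : ordK x (ι c) = ordF x hh.choose := dif_pos hh
    rw [h1, ← hinj hh.choose_spec]
  -- every rational function lies in the subfield generated by the image `t′` of `t`
  let t' : K := ι (algebraMap ℚ[X] F X)
  have hpoly : ∀ (L : Subfield K), t' ∈ L → ∀ p : ℚ[X], ι (algebraMap ℚ[X] F p) ∈ L := by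
    intro L ht p
    induction p using Polynomial.induction_on' with
    | add p q hp hq => rw [map_add, map_add]; exact L.add_mem hp hq
    | monomial n r =>
      rw [← C_mul_X_pow_eq_monomial, map_mul, map_pow, map_mul, map_pow, RatFunc.algebraMap_C]
      refine L.mul_mem ?_ (L.pow_mem ht n)
      have hC : ι (RatFunc.C r) = (r : K) := by rw [eq_ratCast, map_ratCast]
      rw [hC]
      exact SubfieldClass.ratCast_mem L r
  have hrat : ∀ (L : Subfield K), t' ∈ L → ∀ c : F, ι c ∈ L := by
    intro L ht c
    refine RatFunc.induction_on (P := fun c : F => ι c ∈ L) c fun p q _ => ?_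
    rw [map_div₀]
    exact L.div_mem (hpoly L ht p) (hpoly L ht q)
  /- `hfg`: fixed fields of open normal subgroups are finite over `ℚ(t)`, hence inside `ℚ(t′, basis)` -/
  have hfgN : ∀ H : OpenNormalSubgroup N.piRat, ∃ s : Finset N.Krat,
      ∀ a : N.Krat, (∀ h : N.piRat, h ∈ H → h • a = a) → a ∈ IntermediateField.adjoin ℚ (s : Set N.Krat) := by
    intro H
    let Hs : Subgroup (K ≃ₐ[F] K) := H.toSubgroup
    let E : IntermediateField F K := IntermediateField.fixedField Hs
    have hmemE : ∀ y : K, (∀ h : G, h ∈ H → h • y = y) → y ∈ E := by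
      intro y hy
      rw [IntermediateField.mem_fixedField_iff]
      intro f hf
      exact hy f hf
    let Hc : ClosedSubgroup (K ≃ₐ[F] K) := ⟨Hs, H.toOpenSubgroup.isClosed⟩
    have hfix : E.fixingSubgroup = Hs := InfiniteGalois.fixingSubgroup_fixedField Hc
    haveI : FiniteDimensional F E := by
      refine (InfiniteGalois.isOpen_iff_finite E).1 ?_
      rw [hfix]
      exact H.toOpenSubgroup.isOpen'
    let b := Module.finBasis F E
    let s : Finset K := insert t' (Finset.univ.image fun i => ((b i : E) : K))
    refine ⟨s, fun a hfa => ?_⟩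
    -- membership in the SUBFIELD generated by `s` suffices (any `ℚ`-algebra structure)
    let L : Subfield K := Subfield.closure (s : Set K)
    have htL : t' ∈ L := Subfield.subset_closure (Finset.mem_coe.mpr (Finset.mem_insert_self _ _))
    have hbL : ∀ i, ((b i : E) : K) ∈ L := fun i =>
      Subfield.subset_closure (Finset.mem_coe.mpr
        (Finset.mem_insert_of_mem (Finset.mem_image.mpr ⟨i, Finset.mem_univ i, rfl⟩)))
    have haE : a ∈ E := hmemE a hfa
    set e : E := ⟨a, haE⟩ with he
    have hrepr := b.sum_repr e
    have ha_eq : a = ∑ i, ι (b.repr e i) * ((b i : E) : K) := by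
      have h1 : a = ((∑ i, b.repr e i • b i : E) : K) := by rw [hrepr]
      rw [h1, IntermediateField.coe_sum]
      refine Finset.sum_congr rfl fun i _ => ?_
      rw [IntermediateField.coe_smul, Algebra.smul_def]
    have haL : a ∈ L := by
      rw [ha_eq]
      exact L.sum_mem fun i _ => L.mul_mem (hrat L htL _) (hbL i)
    exact (Subfield.closure_le (t := (IntermediateField.adjoin ℚ (s : Set K)).toSubfield)).mpr
      (IntermediateField.subset_adjoin ℚ (s : Set K)) haL
  -- the old law (iv) `hdiv` follows (w4-d050's `hdiv_of_fixed_subset_adjoin_finset`)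
  have hdivN := N.hdiv_of_fixed_subset_adjoin_finset hfgN
  -- the explicit κ-coric function and its properties
  obtain ⟨c₀, hc₀, hc₀nc⟩ := exists_isKappaCoric_rat
  obtain ⟨x₁, x₂, hx, hx₁, hx₂⟩ := hc₀.exists_two_zeroes _ hc₀nc
  refine ⟨N, (inferInstance : CharZero K), ℚ, ordK, ?_, ?_, hT1, hTpow, hfgN, hdivN, ?_, ?_,
    ⟨ι c₀, (S.isInftyKappaCoricIn_algebraMap_iff_isKappaCoric K c₀).mpr hc₀, hfix_alg c₀, x₁, x₂, hx, ?_, ?_⟩⟩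
  · -- `hroot`: `Λ` is algebraically closed
    exact fun a _ n hn => IsAlgClosed.exists_pow_nat_eq a hn
  · -- `hprim`: all roots of unity
    intro n hn
    haveI : NeZero (n : K) := ⟨Nat.cast_ne_zero.mpr hn.ne'⟩
    exact HasEnoughRootsOfUnity.exists_primitiveRoot K n
  · -- `hordmul`: fixed non-zero elements are rational functions and `ord_x` is additive there
    intro x a b ha hb hfa hfb
    obtain ⟨ca, rfl⟩ := hfixed a hfa
    obtain ⟨cb, rfl⟩ := hfixed b hfb
    have hca : ca ≠ 0 := fun h => ha (by rw [h, map_zero])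
    have hcb : cb ≠ 0 := fun h => hb (by rw [h, map_zero])
    change ordK x (ι ca * ι cb) = ordK x (ι ca) + ordK x (ι cb)
    rw [← map_mul, ord_alg, ord_alg, ord_alg]
    exact ratFunc_ord_mul x hca hcb
  · -- `hpole`: a fixed ∞κ-coric element is a κ-coric rational function, which has at most one pole
    intro f' hf' hfix y₁ y₂ hy
    obtain ⟨g, hg, rfl⟩ := (S.isInftyKappaCoricIn_and_fixed_iff K f').mp ⟨hf', hfixσ f' hfix⟩
    change ¬ (ordK y₁ (ι g) < 0 ∧ ordK y₂ (ι g) < 0)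
    rw [ord_alg, ord_alg]
    exact hg.not_two_poles _ hy
  · rw [ord_alg]; exact hx₁
  · rw [ord_alg]; exact hx₂

/-- **The `_of_fg` closer FIRES at the arithmetic function-field model** (shape check by name): abc-iut-w4-d050's
`NFBridgeRecon.existsUniqueCoricStructure_infκPair_fieldLevel_of_fg` (p447949) applied to the witnesses yields
`ExistsUniqueCoricStructure π₁^rat 𝕄^⊛_∞κ` at `K_rat = (ℚ(t))‾`.  [REMARK, not typed here: the ∞κ× side being
collapsed onto the ∞κ side at this model, the `…_infκxPair_fieldLevel_of_fg` closer fires too — TYPED, with the ∞κ×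
side FAITHFUL instead, in the sequel `GlobalFrobenioidsCoricFieldLevelArithmeticModelUnits.lean`,
`exists_faithful_fieldLevel_of_fg_fire_arithmetic`.]  NV annex; inhabited ≠ discharged.
([IUTchI] Ex 5.1 (v) p.128) [claim: Mochizuki2012, status: disputed] -/
theorem exists_infκ_fieldLevel_of_fg_fires_arithmetic :
    ∃ (N : NFBridgeRecon.{0}) (_ : CharZero N.Krat),
      ExistsUniqueCoricStructure N.piRat N.infκPair := by
  obtain ⟨N, hc, X, ord, hroot, hprim, h1, hpow, hfg, -, hordmul, hpole, hex⟩ :=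
    exists_infκ_fieldLevel_laws_arithmetic
  haveI := hc
  exact ⟨N, hc, N.existsUniqueCoricStructure_infκPair_fieldLevel_of_fg hroot hprim h1 hpow hfg ord hordmul hpole hex⟩

end CoricArithmeticToy

end NFBridgeRecon

end Literature.IUT.HodgeTheaters

end
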